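import Mathlib
import HarnessLib
import HarnessLib.Audit
import Summits.KontsevichZagierPeriods.Statement
import HarnessLib.Audit.Status.Attr

/-!
Route: WZCosetWall

DORMANT since 2026-08-24T05:52:41Z (reconciler: no traction for 6.6 d (last activity item-proof-filed at 2026-08-17T15:32:12Z); parked, not closed — `ledger route dormant route-KontsevichZagierPeriods-WZCosetWall --off` to reactivate) — unstaffed, not closed; items shared with open routes are served there. `ledger route dormant <id> --off` reactivates.

# Route WZCosetWall — Σ is a geometric series — WZ certificates compile to Newton–Leibniz moves;
Carlson's constancy step is the coset wall (Gauss multiplication)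

Card realised: wz-resummation-coset-wall ("Σ is a geometric series"). Every proof by SUMMATION
(Gosper/Zeilberger/WZ pairs, the
A=B technology, and every termwise-integration step of analysis incl. KZ's own ζ(2) example,
KontsevichZagier2001 §1.2 p. 9) uses
two non-finitary steps: (Σ) TERMWISE SUMMATION of a sequence of identities, and (C) CONSTANCY of a
1-periodic function of the
auxiliary parameter k (the "periodic Carlson theorem", Guillera2025 Thm 1.1 + [Almkvist];
EkhadZeilberger1995 for Bauer's 2/π series;
AndrewsAskeyRoy1999 Thm 2.8.1–2.8.2 for Dougall/Gauss). X = SummationClosure ∧ SeriesKernel ("it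
suffices to show"):
(Σ) SummationClosure — the four-move relation group `KZ.relations` is closed under DOMINATED
RATIONAL-GEOMETRIC TERMWISE SUMMATION:
if [σ, Σ_j f_j·C(m+j,j)·q^m] − [τ, Σ_j g_j·C(m+j,j)·q'^m] is a relation for every m (|q|,|q'| < 1,
the dominating sums integrable),
then the resummed pair [σ, Σ_j f_j/(1−q)^{j+1}] − [τ, Σ_j g_j/(1−q')^{j+1}] is a relation; (K)
SeriesKernel — Conjecture 1 for the
calculus in which that summation is a fifth rule. The card's attack on both: (Σ) is a THEOREM for
every family carrying a uniform
certificate — hypergeometric term ↦ Euler/beta integrand with geometric n-dependence (zΠx_i)^n,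
polynomial weights ↦ derivatives of
1/(1−y), denominators 1/(n+α) ↦ one unfolded variable, contiguity ↦ ONE Newton–Leibniz move whose
primitive is the resummed
ALGEBRAIC function g/(1−zΠx_i)^{d+1} (support ResummedPrimitiveNL; first compiled certificate = crux
BauerHalfShift; simplest
instance = KZ's own un-derived step, support ZetaTwoOddEven); and the residue of (K) on the
hypergeometric sector is exactly (C):
WZ chains move the parameter only inside k₀ + ℤ, the terminating/trivialising anchors sit in another
coset, and "1-periodic ⇒
constant" is the whole transcendence content of Gauss's multiplication formula (φ(x) =
ΠΓ(x+j/3)/(Γ(3x)3^{−3x}) is 1/3-periodic by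
Γ(s+1) = sΓ(s) alone). Typed first instances of the wall: BauerAccessible (level 4, index-2 coset:
predicted accessible, most
informative either way) and TriplicationThirdShift (the 1/3-periodicity IS a chain; hence Neg 0311 /
0312 is one statement per
coset 1/9 + ⅓ℤ, and Carlson's step for odd multiplication = 0312 exactly).
Lean: `SummationClosure ∧ SeriesKernel`

## Assembly
Pure logic, proved as an `example` in the planner's Sketch.lean (rc 0): given c with KZ.eval c = 0,
apply SeriesKernel at
R := KZ.relations (le_rfl; closure under the summation rule is literally SummationClosure) to get c
∈ KZ.relations, i.e.
Literature.NumberTheory.Transcendental.KZKernelConjecture, then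
Theorems/KernelFormKernelImpliesStatement.lean
(Summit.KontsevichZagierPeriods.KernelForm.kontsevichZagierPeriods_of_kzKernelConjecture). The
concrete cruxes 2–4 are the
informative tests of the line (compiled certificate, coset periodicity, the first coset anchor);
they enter the summit only through
SeriesKernel's hypergeometric sector, as the card says ("assembly to the summit only through the
general hypergeometric sector").

Rationale: WHY THIS LINE. The largest existing corpus of machine-certified proofs of period identities — WZ
pairs and creative telescoping (WilfZeilberger1992,
PetkovsekWilfZeilberger1996; for 1/π^m series EkhadZeilberger1995 = doi:10.1142/9789812797131_0009,
Guillera2006, Guillera2010, Guillera2018, Guillera2025; survey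
BaruahBerndtChan2009, Zudilin2008) — has never been read against KZ's rules; the dictionary above
turns each certificate into a finite
list of KZ moves with an explicit failure locus, because a family of integrations by parts whose
primitives are g·(zΠx_i)^n resums to
one integration by parts with the algebraic primitive g/(1−zΠx_i) ("Σ is a geometric series"). What
does NOT compile is named by the
literature itself: Guillera2025 §1 proves Σ_n G(n,k) is 1-PERIODIC for a flawless pair and invokes
the periodic Carlson theorem to make
it constant, reading the constant at a half-integer where (0)_n kills the series or at k → +∞;
EkhadZeilberger1995 (Zudilin2008 §3,
p. 5 read) does the same for Bauer at k = −1/2; AndrewsAskeyRoy1999 pp. 109–110 (read) derive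
Dougall and Gauss from integer cases by
Carlson. Inside the calculus periodicity is free and constancy is not: this is Neg's pressure point
(b) (Γ-detours) seen from the
summation side, and it localises it to ONE statement per coset (crux TriplicationThirdShift).
Imported areas: symbolic summation /
holonomic certificates (combinatorics, computer algebra) with an explicit object-to-object
dictionary; hypergeometric analysis
(Carlson, Dougall); no spectral/probabilistic/physical reformulation applies. New versus the tree:
no route or item compiles DISCRETE
telescoping (GaussManinCertificates transports a CONTINUOUS parameter; two-route/mellin cards are
unrouted and treat ₂F₁ transformations
and exponent shifts); negatives index empty (checked 2026-08-15).

RANKED CRUXES. #0 SeriesKernel (target) — Conjecture 1 for the calculus KZ^Σ = four moves + the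
rational-geometric termwise-summation rule: ker KZ.eval is contained in every subgroup R ≥
KZ.relations closed under the rule (phrased over R, as in LiouvilleUnfolding.LogKernelConjecture).
KZKernelConjecture ⇒ it trivially; with SummationClosure it gives KZKernelConjecture back (the
Assembly). Filed so that the summation rule is load-bearing and KZ^Σ is on record as a formal
object; refuters read it as the summit. (why it might fail: Summit-strength: KZKernelConjecture ⇒ it
⇒ (with SummationClosure) KZKernelConjecture; inherits the GPC-strength barriers and Neg's pressure
points — the coset anchors this route isolates (Carlson steps) are not instances of the summation
rule.) [KontsevichZagier2001, HuberMullerStach2017, Ayoub2015, Guillera2025]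
#2 BauerAccessible (crux) — Bauer–Ramanujan Σ_{n≥0} (−1)^n (4n+1) ((1/2)_n/n!)³ = 2/π as a
KZ-LITERAL pair (card item BauerRep): with (1/2)_n/n! = (4/π)∫₀¹ (2t/(1+t²))^{2n} dt/(1+t²) and Σ_n
(4n+1)(−W)^n = (1−3W)/(1+W)², the 3-dim rational rep [(0,1)³, (1−3W)/((1+W)²·Π_i(1+t_i²))], W = Π_i
4t_i²/(1+t_i²)², and the 2-dim rational rep [(0,1)², 1/(2(1+x²)(1+y²))] both have value π²/32
(refuter midpoint check 0.3084262 vs 0.3084251; series checked to 4e-7 this session) —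
KZ.Equivalent. The WZ route supplies [S(−1/2)] ~ [S(1/2)]/2 ~ … (crux 3) but no anchor in −1/2 + ℤ;
the classical route is Clausen + Legendre's relation + the lemniscatic CM value (correspondence
cards). Conjecture 1 predicts a chain; the card's coset heuristic predicts the index-2 jump is the
accessible kind. [deps: BauerHalfShift] [difficulty: XL] (why it might fail: Every known proof
leaves the calculus: WZ needs Carlson to jump the coset −1/2 → 0 (Zudilin2008 p. 5; Guillera2025 Thm
1.1), the classical proof needs Clausen + Legendre + a CM evaluation; if neither the coset jump nor
the isogeny compiles, this IsRational cube pair is a Neg witness.) [doi:10.1142/9789812797131_0009,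
Zudilin2008, Guillera2025, BaruahBerndtChan2009, KontsevichZagier2001]
#3 BauerHalfShift (crux) — THE COMPILED CERTIFICATE (card item BauerCosetChain). Ekhad–Zeilberger's
pair F(n,k) = (4n+1)(−1)^n (1/2)_n²(−k)_n/(n!²(3/2+k)_n)·Γ(3/2)Γ(1+k)/Γ(3/2+k), G =
(2n+1)²/((2n+2k+3)(4n+1))·F, certifies Σ_n F(n,−1/2) = Σ_n F(n,1/2) (checked termwise this session:
F(n,−½) − F(n,½) = G(n) − G(n−1) with (4n+1)(4n²+2n−1) = 16n³+12n²−2n−1), i.e. S(1/2) = 2·S(−1/2)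
where S(1/2) = Σ_n (4n+1)(−1)^n c_n²·[(−1/2)_n/n!]/(n+1) = 4/π is the COMPANION series (c_n =
(1/2)_n/n!). Resummed in Euler form ((−1/2)_n/n! ↦ coefficients of (1−X)^{1/2}, 1/(n+1) ↦ ∫₀¹u^n
du): π·∫_{(0,1)³}(x₁x₂(1−x₁)(1−x₂))^{−1/2}(1+3x₁x₂u)/√(1+x₁x₂u) =
2·∫_{(0,1)³}Π(x_i(1−x_i))^{−1/2}(1−3Φ)/(1+Φ)², Φ = x₀x₁x₂ (both sides 4π², integrals checked to 1e-8
and 3e-13). Claim: the 4-dim rep (the factor π unfolded as ∫₀¹(y(1−y))^{−1/2}dy) and the 3-dim rep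
are KZ.Equivalent, by the compiled certificate: slab lift to a common cube, the pointwise resummed
identity "difference = ∂₁𝒜 + ∂₂ℬ + ∂₃𝒞" with algebraic 𝒜,ℬ,𝒞 (resummed beta-contiguity primitives
x^{n+1/2}(1−x)^{1/2}·(−Φ)^n ↦ x^{1/2}(1−x)^{1/2}·rational(Φ)), three ResummedPrimitiveNL moves with
vanishing boundary terms, integrand additivity; no limit, no Carlson (lim_N G(N) = 0 enters only as
pointwise convergence of the resummed kernel). [deps: ResummedPrimitiveNL] [difficulty: L] (why it
might fail: As typed the chain needs the resummed pointwise identity on (0,1)^4 after a slab lift,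
the n = 0 split hidden in (−1/2)_n = −(1/2)_n/(2n−1), absolute integrability of every resummed
divergence term at the faces, rational scaling via slab + product ideal; one missed side condition
breaks it.) [doi:10.1142/9789812797131_0009, PetkovsekWilfZeilberger1996, WilfZeilberger1992,
Zudilin2008]
#4 TriplicationThirdShift (crux) — CARLSON'S STEP = THE COSET WALL, typed at Gauss triplication.
I(x) := B(x, x+1/3)·B(2x+1/3, x+2/3) = Γ(x)Γ(x+1/3)Γ(x+2/3)/Γ(3x+1) = 2π·3^{1/2−3x}/(3x) satisfies
(3x+1)·I(x+1/3) = x·I(x) (checked to 1e-15 at x = 1/9, 0.7, 2.3), and this 1/3-PERIODICITY is a KZ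
chain for every rational x > 0: Dirichlet's change of variables (t,s) ↦ (st, s(1−t)) turns each
product rep into a simplex rep ∬ u^{a−1}v^{b−1}(1−u−v)^{c−1} (one rule-2 move), the simplex rep is
symmetric under permuting (u, v, 1−u−v) (linear moves), and D(x+1, x+1/3, x+2/3) = (x/(3x+1))·D(x,
x+1/3, x+2/3) is ONE integration by parts in u. Claim: the 2-dim reps [(0,1)²,
(3x+1)·t^{x−2/3}(1−t)^{x−1/3}s^{2x}(1−s)^{x}] and [(0,1)²,
x·t^{x−1}(1−t)^{x−2/3}s^{2x−2/3}(1−s)^{x−1/3}] are KZ.Equivalent. Consequences (rational scaling of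
relations is derivable: slab move + KZProductIdeal.mul_mem_relations_left_holds): accessibility of
the Gauss-triplication identity is constant on cosets x + ⅓ℤ; the coset of 1/3 is anchored by
reflection B(1/3,2/3) = 2π/√3 (mellin card H2, d ≤ 2); at x = 1/9 the second rep is (1/9)× the
integrand of Neg 0311 / 0312 verbatim, so 0312 ⟺ its whole coset {1/9, 4/9, 7/9, …} and
"1/3-periodic ⇒ constant" (Carlson/Bohr–Mollerup) is exactly what the calculus must replace there.
[difficulty: M] (why it might fail: The Dirichlet map must be ONE changeOfVariablesRel instance on
the open square (InjOn, HasFDerivWithinAt, image = open simplex exactly); the IBP boundary term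
u^x·v^{x−2/3}(1−u−v)^{x+2/3} → 0 needs x > 0 at both ends of every fibre; corner integrability of
the permuted simplex reps for small x.) [AndrewsAskeyRoy1999, Deligne1982HodgeCycles,
Waldschmidt2006, Guillera2025, KontsevichZagier2001]
#5 SummationClosure (crux) — (Σ) of the Thesis with R := KZ.relations: the four-move relation group
is closed under dominated rational-geometric termwise summation (two families r_m = [σ, Σ_{j<d}
f_j·C(m+j,j)·q^m], s_m = [τ, Σ_{j<d'} g_j·C(m+j,j)·q'^m] with |q|,|q'| < 1 on the domains, resummed
reps rs = [σ, Σ_j f_j/(1−q)^{j+1}], ss = [τ, Σ_j g_j/(1−q')^{j+1}], dominating functions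
Σ_j|f_j|/(1−|q|)^{j+1} and Σ_j|g_j|/(1−|q'|)^{j+1} integrable; if [r_m] − [s_m] ∈ relations for all
m then [rs] − [ss] ∈ relations). The binomial basis C(m+j,j) spans polynomial weights (Σ_m
C(m+j,j)q^m = (1−q)^{−j−1}) and is stable under index shifts (Pascal), so every WZ k-step — after
unfolding denominators 1/(n+α) into a variable and splitting finitely many initial terms — is
finitely many instances. Sound: ker eval is closed under the rule (dominated convergence), so the
summit implies it. The card's engine proves every instance that comes with a UNIFORM certificate
(primitives P·C(m+j,j)q^m ↦ one move with primitive P/(1−q)^{j+1}, support ResummedPrimitiveNL); the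
abstract closure is the honest open part. [deps: ResummedPrimitiveNL] [difficulty: open-problem]
(why it might fail: Implied by the summit, but no finitary proof can exist in the abstract: the
termwise chains may be unrelated, only uniformly certified families resum. A termwise-accessible
family with inaccessible resummation (e.g. around a conditionally convergent 1/π series) would
refute it AND the summit.) [KontsevichZagier2001, PetkovsekWilfZeilberger1996, WilfZeilberger1992,
HuberMullerStach2017]
#9 ResummedPrimitiveNL (support) — The engine as one packaged move (card lemma ResummedCertificate):
on a band {x ∈ τ, a x ≤ t ≤ b x} with ℚ-semialgebraic P, q, |q| < 1 on the closed band, P and q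
continuous on closed fibres and t-differentiable on open fibres with derivatives P', q', the rep
with integrand ∂_t(P/(1−q)^{d+1}) = P'/(1−q)^{d+1} + (d+1)·P·q'/(1−q)^{d+2} and the base rep with
integrand P(·,b)/(1−q(·,b))^{d+1} − P(·,a)/(1−q(·,a))^{d+1} differ by a relation. It is
KZ.newtonLeibnizRel with F := P/(1−q)^{d+1}; the work is IsSemialgebraicFunOn of the quotient
(sub/mul/_holds toolkit + inverse of a non-vanishing semialgebraic function) and fibrewise
ContinuousOn/HasDerivAt of the quotient. This is what "a family of IBP moves with primitives
P·C(m+d,d)·q^m resums to ONE move" means formally. [difficulty: provable-now] [KontsevichZagier2001,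
PetkovsekWilfZeilberger1996]
#9 BauerAnchorOne (support) — Calibration of the dictionary at a TERMINATING anchor (card item
TerminatingAnchors): Ekhad–Zeilberger's S(1) = Σ_{n≤1}(4n+1)(−1)^n c_n²(−1)_n/(5/2)_n = 3/2 reads,
with (−1)_n/n! ↦ coefficients of (1−X), n!/(5/2)_n ↦ (3/2)∫x^n(1−x)^{1/2}, as
∫_{(0,1)³}(x₀x₁(1−x₀)(1−x₁))^{−1/2}·√(1−x₂)·(1+5x₀x₁x₂) = π² = ∫_{(0,1)²}(x₀(1−x₀)x₁(1−x₁))^{−1/2}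
(both checked to 1e-10). Chain on paper (6 moves): integrand additivity; Newton–Leibniz in x₂ with
primitives −(2/3)(1−x₂)^{3/2} and the polynomial×(1−x₂)^{3/2} primitive of x₂√(1−x₂) (values 2/3 and
4/15); the contiguity IBP x^{1/2}(1−x)^{−1/2} ~ (1/2)x^{−1/2}(1−x)^{−1/2} (primitive
x^{1/2}(1−x)^{1/2}) in x₀ and in x₁; additivity (2/3 + 1/3 = 1, constants carried inside integrands,
no division of relations). [difficulty: provable-now] [doi:10.1142/9789812797131_0009, Zudilin2008]
#9 ZetaTwoOddEven (support) — The simplest instance of "Σ is a geometric series", and a gap in KZ's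
own accessible-identity example: KontsevichZagier2001 §1.2 (p. 9 read) expands 1/(1−xy) as a
geometric series and integrates termwise to get I = ∫∫_{(0,1)²} dxdy/((1−xy)√(xy)) = Σ 1/(n+½)² =
3ζ(2) — a passage between the reps [(0,1)², (xy)^{−1/2}/(1−xy)] and [(0,1)², 3/(1−xy)] (both π²/2)
that rules 1)–3) must supply. Compiled: the even/odd splitting of Σ 1/m² is the POINTWISE identity
1/(1−xy) = 1/(1−x²y²) + xy/(1−x²y²) (integrand additivity) plus the squaring maps (x,y) ↦ (x²,y²)
(rule 2: [ (xy)^{−1/2}/(1−xy) ] = 4·[1/(1−x²y²)], [ xy/(1−x²y²) ] = ¼·[1/(1−uv)]) and integer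
bookkeeping by additivity. A prover warm-up with exactly the shape of the engine (d = 0, q = xy and
q = x²y²). [difficulty: provable-now] [KontsevichZagier2001, BeukersCalabiKolk1993]

TWO-LAYER PLAN. Foreseen glued splits (none filed now): BauerAccessible ⇐ BauerHalfShift-type coset
chain → CosetAnchorHalf ([S(−1/2)] ~ an
accessible level-4 value, e.g. via Clausen-as-correspondence + Legendre at the lemniscatic modulus)
→ BauerAccessible;
BauerHalfShift ⇐ ResummedCertificatePointwise (the algebraic identity on (0,1)^4) →
FaceIntegrability → BauerHalfShift;
TriplicationThirdShift ⇐ DirichletCoV (product rep ~ simplex rep, all (a,b,c)) → SimplexContiguity →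
TriplicationThirdShift.

KILL CRITERIA. Refutation of BauerHalfShift with the side conditions met (the compiled certificate
is NOT a chain) kills the dictionary and
closes the route (close --reason refuted:BauerHalfShift); refutation only as-typed (a face
integrability failure) ⇒ restate with
the offending piece split off. Refutation of TriplicationThirdShift ⇒ the "periodicity is free" half
is wrong: pivot the thesis to
"translation is already a wall" and hand the witness to Neg. Refutation of BauerAccessible =
¬KontsevichZagierPeriods outright (both
reps rational, equal values): the route converts to the Neg witness it names. SummationClosure
refuted ⇒ summit refuted likewise.
Mooted if KZKernelConjecture is proved elsewhere (NoriTransfer/Grothendieck), or if MultivaluedCoV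
proves 0312 AND a CM-correspondence
chain for Bauer (then the coset wall is a presentation artefact: downgrade to the compiled-corpus
support programme).

NOT DECOMPOSED YET. The general compiler (WZ certificate ↦ move list) as a meta-theorem over a
syntax of hypergeometric terms — deliberately not an item
(needs a term language; BostanLairezSalvy2013 / Lairez2015 binomial-sums-as-diagonals for
multisums); the k → +∞ anchor (a LIMIT,
card limit-is-a-move's business); Guillera's 1/π² series (WZ-only proofs, monodromy O₅: Zudilin2008
§3) and the level-3 rational
series Σ(15n+2)(1/2)_n(1/3)_n(2/3)_n/n!³(2/27)^n = 27/(4π) (checked to 1e-12; merged into card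
ramanujan-pi-series per audit) as
the next graded instances; the reflection anchor B(1/3,2/3) = 2π/√3 of the coset 1/3 + ⅓ℤ (mellin
card H2); the q ≠ 3 multiplication
families (same Dirichlet argument gives 1/q-periodicity). Expansion only after crux 3 or 4 closes.

CHEAPEST FALSIFIER. Run the compiled certificate symbolically before proving anything: with
c_n-moments on (0,1)³ × slab, check in a CAS that the
resummed difference of the two BauerHalfShift integrands (after the slab lift) equals ∂₁𝒜 + ∂₂ℬ +
∂₃𝒞 for the resummed primitives
𝒜,ℬ,𝒞 = x_i^{1/2}(1−x_i)^{1/2}·(rational in Φ, u) predicted by the certificate R(n,k) =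
(2n+1)²/((2n+2k+3)(4n+1)), and that each of
∂₁𝒜, ∂₂ℬ, ∂₃𝒞 is absolutely integrable on the open 4-cube (the alternating sign makes every kernel
1/(1+Φu)^m bounded; the only risk is
the x_i^{−1/2} edge times polynomial growth in n, resummed). Planner check done this session: the
termwise WZ identity at k = −1/2
(16n³+12n²−2n−1 on both sides) and all four values (2/π, 4/π, 4π, 2π²) numerically. If the CAS
identity fails, crux 3 is mis-compiled;
if an edge integral diverges, the dictionary needs a blow-up move first.

NUMBERS. S(k) := Σ_n (4n+1)(−1)^n (1/2)_n²(−k)_n/(n!²(3/2+k)_n) = Γ(3/2+k)/(Γ(3/2)Γ(1+k)) (EZ +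
Carlson): S(−1/2) = 2/π, S(0) = 1, S(1/2) = 4/π,
S(1) = 3/2, S(3/2) = 16/(3π) (all checked numerically this session). Bauer cube integral π²/32 =
0.30843; companion I⁺ = 4π; I⁻ = 2π².
Triplication family I(x) = 2π·3^{1/2−3x}/(3x); I(1/9) = B(1/9,4/9)B(5/9,7/9) = 2π·3^{7/6} =
22.6371283 (= Neg 0311's value).
Carlson (AndrewsAskeyRoy1999 Thm 2.8.1): f analytic, O(e^{k|z|}) with k < π on Re z ≥ 0, f(ℕ) = 0 ⇒
f ≡ 0; periodic version used by
Guillera2025: 1-periodic, O(e^{c|Im k|}), c < 2π ⇒ constant. Items at open: 9 (1 target, 4 cruxes, 3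
supports, 1 assembly).

DEFINITION REQUESTS. None at open: everything is stated over
Literature.NumberTheory.Transcendental.KZ.{IntegralRep, of, eval, relations, Equivalent,
FormalRep} and IsSemialgebraicFunOn. Later (layer 2): a Summits-side syntax `HypTerm` (Pochhammer
data + certificate) for the
meta-compiler, topic Summits/KontsevichZagierPeriods/KontsevichZagierPeriods/Theorems.

Novelty: Searches (2026-08-15; local searchd down — connection reset — so hybrid/vsearch unavailable,
recorded in NOTES.md): crossref
"Kontsevich Zagier period conjecture creative telescoping Wilf Zeilberger" (10: Ayoub2015,
Zeilberger 1991, A=B, Koepf 2014, HMS —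
none joins the two), crossref "WZ proof Ramanujan series for 1/pi Guillera" (15 Guillera/Campbell
papers incl. doi:10.1017/s0004972725000231,
doi:10.1007/s11139-018-9998-6 Dougall-by-WZ, doi:10.1142/s1793042120400242 level 3), crossref
"Carlson theorem Gauss multiplication
periodic function constant" (Kairies doi:10.1007/bf01831144 characterisations of Γ by the
multiplication formula), `lit galaxy search
--star all "Wilf-Zeilberger period"` (0), `--star pdf "WZ method"` (Zeilberger math/9811070; nothing
on periods), `--star pdf "period
conjecture"` (HMS 2015 draft, André 0812.3920), `lit frontier KontsevichZagierPeriods --since 2020`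
(14 rows), `lit bridges --cross any`
(30 rows); full-text reads: Zudilin2008 = arXiv:0712.1332 p. 5, Guillera2025 = arXiv:2503.00570 pp.
3–7, AndrewsAskeyRoy1999 pdf pp. 90–91,
KontsevichZagier2001 p. 9 and p. 16 (Beukers' ζ(3) proof "by integrating by parts n times" — rules
applied termwise in n, again outside
a finite chain).
Nearest prior art found: EkhadZeilberger1995 (doi:10.1142/9789812797131_0009) / Zudilin2008 §3 (the
certificate compiled in crux 3 and its
Carlson step); Guillera2025 Thm 1.1 (1-periodicity of Σ_n G(n,k) for flawless pairs + periodic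
Carlson; constants read at k = 1/2 or  [refs: 10.1017/s0004972725000231, 10.1007/s11139-018-9998-6, 10.1142/s1793042120400242, 10.1007/bf01831144, 10.1142/9789812797131_0009, 0712.1332, 2503.00570, doi:10.1017/s0004972725000231, doi:10.1007/s11139-018-9998-6, doi:10.1142/s1793042120400242, doi:10.1007/bf01831144, doi:10.1142/9789812797131_0009, Ayoub2015, Zudilin2008, Guillera2025, AndrewsAskeyRoy1999, KontsevichZagier2001]

Barriers (technique_class: discrete-telescoping resummation, coset periodicity): - technique_class: discrete-telescoping resummation, coset periodicity
- Literature.Barriers.KontsevichZagierPeriods.noSemialgebraicPrimitive_inv_sub_two: evaded by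
construction — every primitive the line uses is P·q^m or its resummation P/(1−q)^{d+1}, algebraic
because q = zΠx_i is; the summation index is resummed, never integrated out; denominators 1/(n+α)
are unfolded into a variable (u^{α−1}), never integrated; the barrier's scope (eliminating a
variable with an admissible primitive) is not touched.
- Literature.Barriers.KontsevichZagierPeriods.kzConjecture_implies_oddZetaAlgIndep: applies verbatim
to SeriesKernel (summit-strength, admitted) and to nothing else: SummationClosure, BauerHalfShift,
TriplicationThirdShift, the supports assert derivability of identities already known to hold and
prove no number transcendental; BauerAccessible is one accessibility instance (Conjecture 1 predicts
it).
- Literature.Barriers.KontsevichZagierPeriods.kzConjecture_implies_twoPiI_log_algIndep: same —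
inherited by SeriesKernel only.
- Literature.Barriers.KontsevichZagierPeriods.kzConjecture_implies_ellipticPeriods_algIndep: same —
inherited by SeriesKernel only; BauerAccessible's classical proof runs through lemniscatic elliptic
periods but the item asserts a chain, not an independence.
- Literature.Barriers.KontsevichZagierPeriods.cressonViuSos_prop_3_2: not engaged — no global
semialgebraic homeomorphism is posited; dimension changes happen by unfolding (slab/NL) and
products.
- Lite

Novelty grade: new-combination — ROUTE-REVIEW gen-2 (refuter, 2026-08-15; independent re-check of gen-0; novelty unchanged = refuter-novelty-9 audit, searchd down). VERDICT: KEEP OPEN; all 9 items stamped check --elaborates true with per-item prover briefings. (1) File materialised (rev0 d6f4e3e0de8e); all 9 decls elaborate against (refuter refuter-rreview-route-AtomisticToContinu-680f7413-g2-0, 2026-08-15T14:14:09Z; prior: doi:10.1142/9789812797131_0009, arXiv:0712.1332, arXiv:2503.00570, AndrewsAskeyRoy1999 Thm 2.8.1, KontsevichZagier2001 §1.2)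

History (route lifecycle, newest last):
- 2026-08-16T04:09:53Z · AUTO-CRUX (backfill): SeriesKernel — hypotheses of the deciding theorem that nothing in the route derives are cruxes (operator:999:1085951)
- 2026-08-24T05:52:41Z · DORMANT — reconciler: no traction for 6.6 d (last activity item-proof-filed at 2026-08-17T15:32:12Z); parked, not closed — `ledger route dormant route-KontsevichZagierPer (operator:999:3488970)

sub-problem: KontsevichZagierPeriods · status: dormant · opened planner-plancard-KontsevichZagierPeriods-Kont-e65def99-0 2026-08-15T11:54:35Z · rev 1 · ledger route-KontsevichZagierPeriods-WZCosetWall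
GENERATED by the gate from the ledger (D-0016/17). Provers cite these decls: `theorem foo : Summit.KontsevichZagierPeriods.KontsevichZagierPeriods.Theses.WZCosetWall.<Decl> := …` in Summits/KontsevichZagierPeriods/KontsevichZagierPeriods/Theorems/<Name>.lean.
-/

namespace Summit.KontsevichZagierPeriods.KontsevichZagierPeriods.Theses.WZCosetWall

open scoped BigOperators Topology Manifold Classical MeasureTheory ProbabilityTheory Matrix InnerProductSpace ComplexConjugate ContinuousMap
open Filter Set Function TopologicalSpace MeasureTheory

attribute [summit_statement] _root_.KontsevichZagierPeriods

open Literature Periods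

/-- item stmt-KontsevichZagierPeriods-6872 · crux (kind.auto-crux: conjecture-grade) · rank 0 · open · by planner
why it might fail: Summit-strength: KZKernelConjecture ⇒ it ⇒ (with SummationClosure) KZKernelConjecture; inherits the GPC-strength barriers and Neg's pressure points — the coset anchors this route isolates (Carlson steps) are not instances of the summation rule.
sources: KontsevichZagier2001, HuberMullerStach2017, Ayoub2015, Guillera2025
[target] Conjecture 1 for the calculus KZ^Σ = four moves + the rational-geometric termwise-summation
rule: ker KZ.eval is contained in every subgroup R ≥ KZ.relations closed under the rule (phrased
over R, as in LiouvilleUnfolding.LogKernelConjecture). KZKernelConjecture ⇒ it trivially; with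
SummationClosure it gives KZKernelConjecture back (the Assembly). Filed so that the summation rule
is load-bearing and KZ^Σ is on record as a formal object; refuters read it as the summit. -/
@[route_item "route-KontsevichZagierPeriods-WZCosetWall", crux]
def SeriesKernel : Prop :=
  ∀ (R : AddSubgroup Literature.NumberTheory.Transcendental.KZ.FormalRep), Literature.NumberTheory.Transcendental.KZ.relations ≤ R → (∀ (n n' d d' : ℕ) (q : (Fin n → ℝ) → ℝ) (q' : (Fin n' → ℝ) → ℝ) (f : Fin d → (Fin n → ℝ) → ℝ) (g : Fin d' → (Fin n' → ℝ) → ℝ) (r : ℕ → Literature.NumberTheory.Transcendental.KZ.IntegralRep n) (s : ℕ → Literature.NumberTheory.Transcendental.KZ.IntegralRep n') (rs : Literature.NumberTheory.Transcendental.KZ.IntegralRep n) (ss : Literature.NumberTheory.Transcendental.KZ.IntegralRep n'), (∀ m, (r m).domain = rs.domain) → (∀ m, (s m).domain = ss.domain) → (∀ x ∈ rs.domain, |q x| < 1) → (∀ y ∈ ss.domain, |q' y| < 1) → (∀ m, ∀ x ∈ rs.domain, (r m).integrand x = ∑ j : Fin d, f j x * ((m + (j : ℕ)).choose j : ℝ)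 * q x ^ m) → (∀ m, ∀ y ∈ ss.domain, (s m).integrand y = ∑ j : Fin d', g j y * ((m + (j : ℕ)).choose j : ℝ) * q' y ^ m) → (∀ x ∈ rs.domain, rs.integrand x = ∑ j : Fin d, f j x / (1 - q x) ^ ((j : ℕ) + 1)) → (∀ y ∈ ss.domain, ss.integrand y = ∑ j : Fin d', g j y / (1 - q' y) ^ ((j : ℕ) + 1)) → MeasureTheory.IntegrableOn (fun x => ∑ j : Fin d, |f j x| / (1 - |q x|) ^ ((j : ℕ) + 1)) rs.domain → MeasureTheory.IntegrableOn (fun y => ∑ j : Fin d', |g j y| / (1 - |q' y|) ^ ((j : ℕ) + 1)) ss.domain → (∀ m, Literature.NumberTheory.Transcendental.KZ.of (r m) - Literature.NumberTheory.Transcendental.KZ.of (s m) ∈ R) → Literature.NumberTheory.Transcendental.KZ.of rs - Literature.NumberTheory.Transcendental.KZ.of ss ∈ R) → ∀ c : Literature.NumberTheory.Transcendental.KZ.FormalRep, Literature.NumberTheory.Transcendental.KZ.eval c = 0 → c ∈ R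

/-- item stmt-KontsevichZagierPeriods-6873 · crux · rank 2 · open · by planner
why it might fail: Every known proof leaves the calculus: WZ needs Carlson to jump the coset −1/2 → 0 (Zudilin2008 p. 5; Guillera2025 Thm 1.1), the classical proof needs Clausen + Legendre + a CM evaluation; if neither the coset jump nor the isogeny compiles, this IsRational cube pair is a Neg witness.
sources: doi:10.1142/9789812797131_0009, Zudilin2008, Guillera2025, BaruahBerndtChan2009, KontsevichZagier2001
[crux] Bauer–Ramanujan Σ_{n≥0} (−1)^n (4n+1) ((1/2)_n/n!)³ = 2/π as a KZ-LITERAL pair (card item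
BauerRep): with (1/2)_n/n! = (4/π)∫₀¹ (2t/(1+t²))^{2n} dt/(1+t²) and Σ_n (4n+1)(−W)^n =
(1−3W)/(1+W)², the 3-dim rational rep [(0,1)³, (1−3W)/((1+W)²·Π_i(1+t_i²))], W = Π_i
4t_i²/(1+t_i²)², and the 2-dim rational rep [(0,1)², 1/(2(1+x²)(1+y²))] both have value π²/32
(refuter midpoint check 0.3084262 vs 0.3084251; series checked to 4e-7 this session) —
KZ.Equivalent. The WZ route supplies [S(−1/2)] ~ [S(1/2)]/2 ~ … (crux 3) but no anchor in −1/2 + ℤ;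
the classical route is Clausen + Legendre's relation + the lemniscatic CM value (correspondence
cards). Conjecture 1 predicts a chain; the card's coset heuristic predicts the index-2 jump is the
accessible kind. [deps: BauerHalfShift] [difficulty: XL] -/
@[route_item "route-KontsevichZagierPeriods-WZCosetWall"]
def BauerAccessible : Prop :=
  ∀ (r : Literature.NumberTheory.Transcendental.KZ.IntegralRep 3) (r' : Literature.NumberTheory.Transcendental.KZ.IntegralRep 2), r.domain = {t | ∀ i, t i ∈ Set.Ioo (0:ℝ) 1} → Set.EqOn r.integrand (fun t => (1 - 3 * ∏ i : Fin 3, (4 * t i ^ 2 / (1 + t i ^ 2) ^ 2)) / ((1 + ∏ i : Fin 3, (4 * t i ^ 2 / (1 + t i ^ 2) ^ 2)) ^ 2 * ∏ i : Fin 3, (1 + t i ^ 2))) r.domain → r'.domain = {x | ∀ i, x i ∈ Set.Ioo (0:ℝ) 1} → Set.EqOn r'.integrand (fun x => 1 / (2 * (1 + x 0 ^ 2) * (1 + x 1 ^ 2))) r'.domain → Literature.NumberTheory.Transcendental.KZ.Equivalent r r'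

/-- item stmt-KontsevichZagierPeriods-6874 · crux · rank 3 · open · by planner
why it might fail: As typed the chain needs the resummed pointwise identity on (0,1)^4 after a slab lift, the n = 0 split hidden in (−1/2)_n = −(1/2)_n/(2n−1), absolute integrability of every resummed divergence term at the faces, rational scaling via slab + product ideal; one missed side condition breaks it.
sources: doi:10.1142/9789812797131_0009, PetkovsekWilfZeilberger1996, WilfZeilberger1992, Zudilin2008
[crux] THE COMPILED CERTIFICATE (card item BauerCosetChain). Ekhad–Zeilberger's pair F(n,k) =
(4n+1)(−1)^n (1/2)_n²(−k)_n/(n!²(3/2+k)_n)·Γ(3/2)Γ(1+k)/Γ(3/2+k), G = (2n+1)²/((2n+2k+3)(4n+1))·F,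
certifies Σ_n F(n,−1/2) = Σ_n F(n,1/2) (checked termwise this session: F(n,−½) − F(n,½) = G(n) −
G(n−1) with (4n+1)(4n²+2n−1) = 16n³+12n²−2n−1), i.e. S(1/2) = 2·S(−1/2) where S(1/2) = Σ_n
(4n+1)(−1)^n c_n²·[(−1/2)_n/n!]/(n+1) = 4/π is the COMPANION series (c_n = (1/2)_n/n!). Resummed in
Euler form ((−1/2)_n/n! ↦ coefficients of (1−X)^{1/2}, 1/(n+1) ↦ ∫₀¹u^n du):
π·∫_{(0,1)³}(x₁x₂(1−x₁)(1−x₂))^{−1/2}(1+3x₁x₂u)/√(1+x₁x₂u) =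
2·∫_{(0,1)³}Π(x_i(1−x_i))^{−1/2}(1−3Φ)/(1+Φ)², Φ = x₀x₁x₂ (both sides 4π², integrals checked to 1e-8
and 3e-13). Claim: the 4-dim rep (the factor π unfolded as ∫₀¹(y(1−y))^{−1/2}dy) and the 3-dim rep
are KZ.Equivalent, by the compiled certificate: slab lift to a common cube, the pointwise resummed
identity "difference = ∂₁𝒜 + ∂₂ℬ + ∂₃𝒞" with algebraic 𝒜,ℬ,𝒞 (resummed beta-contiguity primitives
x^{n+1/2}(1−x)^{1/2}·(−Φ)^n ↦ x^{1/2}(1−x)^{1/2}·rational(Φ)), three ResummedPrimitiveNL moves with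
vanishing boundary terms, integrand additivity; no limit, no Carlson (lim_N G(N) = 0 -/
@[route_item "route-KontsevichZagierPeriods-WZCosetWall"]
def BauerHalfShift : Prop :=
  ∀ (r : Literature.NumberTheory.Transcendental.KZ.IntegralRep 4) (r' : Literature.NumberTheory.Transcendental.KZ.IntegralRep 3), r.domain = {z | ∀ i, z i ∈ Set.Ioo (0:ℝ) 1} → Set.EqOn r.integrand (fun z => (z 0 * (1 - z 0)) ^ (-(1:ℝ)/2) * (z 1 * (1 - z 1) * (z 2 * (1 - z 2))) ^ (-(1:ℝ)/2) * (1 + 3 * (z 1 * z 2 * z 3)) / Real.sqrt (1 + z 1 * z 2 * z 3)) r.domain → r'.domain = {x | ∀ i, x i ∈ Set.Ioo (0:ℝ) 1} → Set.EqOn r'.integrand (fun x => 2 * (x 0 * (1 - x 0) * (x 1 * (1 - x 1)) * (x 2 * (1 - x 2))) ^ (-(1:ℝ)/2) * (1 - 3 * (x 0 * x 1 * x 2)) / (1 + x 0 * x 1 * x 2) ^ 2) r'.domain → Literature.NumberTheory.Transcendental.KZ.Equivalent r r'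

/-- item stmt-KontsevichZagierPeriods-6875 · crux · rank 4 · closed · proved by Summit.KontsevichZagierPeriods.WZCosetWall.triplicationThirdShift_proof @ 839f1a0d6428 (prover) · by planner
why it might fail: The Dirichlet map must be ONE changeOfVariablesRel instance on the open square (InjOn, HasFDerivWithinAt, image = open simplex exactly); the IBP boundary term u^x·v^{x−2/3}(1−u−v)^{x+2/3} → 0 needs x > 0 at both ends of every fibre; corner integrability of the permuted simplex reps for small x.
sources: AndrewsAskeyRoy1999, Deligne1982HodgeCycles, Waldschmidt2006, Guillera2025, KontsevichZagier2001
[crux] CARLSON'S STEP = THE COSET WALL, typed at Gauss triplication. I(x) := B(x, x+1/3)·B(2x+1/3,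
x+2/3) = Γ(x)Γ(x+1/3)Γ(x+2/3)/Γ(3x+1) = 2π·3^{1/2−3x}/(3x) satisfies (3x+1)·I(x+1/3) = x·I(x)
(checked to 1e-15 at x = 1/9, 0.7, 2.3), and this 1/3-PERIODICITY is a KZ chain for every rational x
> 0: Dirichlet's change of variables (t,s) ↦ (st, s(1−t)) turns each product rep into a simplex rep
∬ u^{a−1}v^{b−1}(1−u−v)^{c−1} (one rule-2 move), the simplex rep is symmetric under permuting (u, v,
1−u−v) (linear moves), and D(x+1, x+1/3, x+2/3) = (x/(3x+1))·D(x, x+1/3, x+2/3) is ONE integration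
by parts in u. Claim: the 2-dim reps [(0,1)², (3x+1)·t^{x−2/3}(1−t)^{x−1/3}s^{2x}(1−s)^{x}] and
[(0,1)², x·t^{x−1}(1−t)^{x−2/3}s^{2x−2/3}(1−s)^{x−1/3}] are KZ.Equivalent. Consequences (rational
scaling of relations is derivable: slab move + KZProductIdeal.mul_mem_relations_left_holds):
accessibility of the Gauss-triplication identity is constant on cosets x + ⅓ℤ; the coset of 1/3 is
anchored by reflection B(1/3,2/3) = 2π/√3 (mellin card H2, d ≤ 2); at x = 1/9 the second rep is
(1/9)× the integrand of Neg 0311 / 0312 verbatim, so 0312 ⟺ its whole coset {1/9, 4/9, 7/9, …} and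
"1/3-periodic ⇒ constant" -/
@[route_item "route-KontsevichZagierPeriods-WZCosetWall"]
def TriplicationThirdShift : Prop :=
  ∀ x : ℚ, 0 < x → ∀ (r r' : Literature.NumberTheory.Transcendental.KZ.IntegralRep 2), r.domain = {z | ∀ i, z i ∈ Set.Ioo (0:ℝ) 1} → Set.EqOn r.integrand (fun z => (3 * (x : ℝ) + 1) * (z 0) ^ ((x : ℝ) - 2/3) * (1 - z 0) ^ ((x : ℝ) - 1/3) * (z 1) ^ (2 * (x : ℝ)) * (1 - z 1) ^ (x : ℝ)) r.domain → r'.domain = {z | ∀ i, z i ∈ Set.Ioo (0:ℝ) 1} → Set.EqOn r'.integrand (fun z => (x : ℝ) * (z 0) ^ ((x : ℝ) - 1) * (1 - z 0) ^ ((x : ℝ) - 2/3) * (z 1) ^ (2 * (x : ℝ) - 2/3) * (1 - z 1) ^ ((x : ℝ) - 1/3)) r'.domain → Literature.NumberTheory.Transcendental.KZ.Equivalent r r'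

/-- item stmt-KontsevichZagierPeriods-6876 · crux · rank 5 · open · by planner
why it might fail: Implied by the summit, but no finitary proof can exist in the abstract: the termwise chains may be unrelated, only uniformly certified families resum. A termwise-accessible family with inaccessible resummation (e.g. around a conditionally convergent 1/π series) would refute it AND the summit.
sources: KontsevichZagier2001, PetkovsekWilfZeilberger1996, WilfZeilberger1992, HuberMullerStach2017
[crux] (Σ) of the Thesis with R := KZ.relations: the four-move relation group is closed under
dominated rational-geometric termwise summation (two families r_m = [σ, Σ_{j<d} f_j·C(m+j,j)·q^m],
s_m = [τ, Σ_{j<d'} g_j·C(m+j,j)·q'^m] with |q|,|q'| < 1 on the domains, resummed reps rs = [σ, Σ_j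
f_j/(1−q)^{j+1}], ss = [τ, Σ_j g_j/(1−q')^{j+1}], dominating functions Σ_j|f_j|/(1−|q|)^{j+1} and
Σ_j|g_j|/(1−|q'|)^{j+1} integrable; if [r_m] − [s_m] ∈ relations for all m then [rs] − [ss] ∈
relations). The binomial basis C(m+j,j) spans polynomial weights (Σ_m C(m+j,j)q^m = (1−q)^{−j−1})
and is stable under index shifts (Pascal), so every WZ k-step — after unfolding denominators 1/(n+α)
into a variable and splitting finitely many initial terms — is finitely many instances. Sound: ker
eval is closed under the rule (dominated convergence), so the summit implies it. The card's engine
proves every instance that comes with a UNIFORM certificate (primitives P·C(m+j,j)q^m ↦ one move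
with primitive P/(1−q)^{j+1}, support ResummedPrimitiveNL); the abstract closure is the honest open
part. [deps: ResummedPrimitiveNL] [difficulty: open-problem] -/
@[route_item "route-KontsevichZagierPeriods-WZCosetWall", crux]
def SummationClosure : Prop :=
  ∀ (n n' d d' : ℕ) (q : (Fin n → ℝ) → ℝ) (q' : (Fin n' → ℝ) → ℝ) (f : Fin d → (Fin n → ℝ) → ℝ) (g : Fin d' → (Fin n' → ℝ) → ℝ) (r : ℕ → Literature.NumberTheory.Transcendental.KZ.IntegralRep n) (s : ℕ → Literature.NumberTheory.Transcendental.KZ.IntegralRep n') (rs : Literature.NumberTheory.Transcendental.KZ.IntegralRep n) (ss : Literature.NumberTheory.Transcendental.KZ.IntegralRep n'), (∀ m, (r m).domain = rs.domain) → (∀ m, (s m).domain = ss.domain) → (∀ x ∈ rs.domain, |q x| < 1) → (∀ y ∈ ss.domain, |q' y| < 1) → (∀ m, ∀ x ∈ rs.domain, (r m).integrand x = ∑ j : Fin d, f j x * ((m + (j : ℕ)).choose j : ℝ) * q x ^ m) → (∀ m, ∀ y ∈ ss.domain, (s m).integrand y = ∑ j : Fin d', g j y * ((m + (j : ℕ)).choose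 j : ℝ) * q' y ^ m) → (∀ x ∈ rs.domain, rs.integrand x = ∑ j : Fin d, f j x / (1 - q x) ^ ((j : ℕ) + 1)) → (∀ y ∈ ss.domain, ss.integrand y = ∑ j : Fin d', g j y / (1 - q' y) ^ ((j : ℕ) + 1)) → MeasureTheory.IntegrableOn (fun x => ∑ j : Fin d, |f j x| / (1 - |q x|) ^ ((j : ℕ) + 1)) rs.domain → MeasureTheory.IntegrableOn (fun y => ∑ j : Fin d', |g j y| / (1 - |q' y|) ^ ((j : ℕ) + 1)) ss.domain → (∀ m, Literature.NumberTheory.Transcendental.KZ.of (r m) - Literature.NumberTheory.Transcendental.KZ.of (s m) ∈ Literature.NumberTheory.Transcendental.KZ.relations) → Literature.NumberTheory.Transcendental.KZ.of rs - Literature.NumberTheory.Transcendental.KZ.of ss ∈ Literature.NumberTheory.Transcendental.KZ.relations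

/-- item stmt-KontsevichZagierPeriods-6877 · support · rank 9 · closed · proved by Summit.KontsevichZagierPeriods.WZCosetWall.resummedPrimitiveNL_proof @ d607e6088f31 (prover) · by planner
sources: KontsevichZagier2001, PetkovsekWilfZeilberger1996
[support] The engine as one packaged move (card lemma ResummedCertificate): on a band {x ∈ τ, a x ≤
t ≤ b x} with ℚ-semialgebraic P, q, |q| < 1 on the closed band, P and q continuous on closed fibres
and t-differentiable on open fibres with derivatives P', q', the rep with integrand
∂_t(P/(1−q)^{d+1}) = P'/(1−q)^{d+1} + (d+1)·P·q'/(1−q)^{d+2} and the base rep with integrand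
P(·,b)/(1−q(·,b))^{d+1} − P(·,a)/(1−q(·,a))^{d+1} differ by a relation. It is KZ.newtonLeibnizRel
with F := P/(1−q)^{d+1}; the work is IsSemialgebraicFunOn of the quotient (sub/mul/_holds toolkit +
inverse of a non-vanishing semialgebraic function) and fibrewise ContinuousOn/HasDerivAt of the
quotient. This is what "a family of IBP moves with primitives P·C(m+d,d)·q^m resums to ONE move"
means formally. [difficulty: provable-now] -/
@[route_item "route-KontsevichZagierPeriods-WZCosetWall"]
def ResummedPrimitiveNL : Prop :=
  ∀ (n d : ℕ) (r : Literature.NumberTheory.Transcendental.KZ.IntegralRep (n + 1)) (r' : Literature.NumberTheory.Transcendental.KZ.IntegralRep n) (a b : (Fin n → ℝ) → ℝ) (P P' q q' : (Fin (n + 1) → ℝ) → ℝ), Literature.NumberTheory.Transcendental.IsSemialgebraicFunOn ℚ r'.domain a → Literature.NumberTheory.Transcendental.IsSemialgebraicFunOn ℚ r'.domain b → (∀ x ∈ r'.domain, a x ≤ b x) → r.domain = {z | (Fin.init z : Fin n → ℝ) ∈ r'.domain ∧ a (Fin.init z) ≤ z (Fin.last n) ∧ z (Fin.last n) ≤ b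 (Fin.init z)} → Literature.NumberTheory.Transcendental.IsSemialgebraicFunOn ℚ r.domain P → Literature.NumberTheory.Transcendental.IsSemialgebraicFunOn ℚ r.domain q → (∀ z ∈ r.domain, |q z| < 1) → (∀ x ∈ r'.domain, ContinuousOn (fun t : ℝ => P (Fin.snoc x t)) (Set.Icc (a x) (b x)) ∧ ContinuousOn (fun t : ℝ => q (Fin.snoc x t)) (Set.Icc (a x) (b x))) → (∀ x ∈ r'.domain, ∀ t ∈ Set.Ioo (a x) (b x), HasDerivAt (fun s : ℝ => P (Fin.snoc x s)) (P' (Fin.snoc x t)) t ∧ HasDerivAt (fun s : ℝ => q (Fin.snoc x s)) (q' (Fin.snoc x t)) t) → (∀ x ∈ r'.domain, ∀ t ∈ Set.Ioo (a x) (b x), r.integrand (Fin.snoc x t) = P' (Fin.snoc x t) / (1 - q (Fin.snoc x t)) ^ (d + 1) + ((d : ℝ) + 1) * P (Fin.snoc x t) * q' (Fin.snoc x t) / (1 - q (Fin.snoc x t)) ^ (d + 2)) → (∀ x ∈ r'.domain, r'.integrand x = P (Fin.snoc x (b x)) / (1 - q (Fin.snoc x (b x))) ^ (d + 1) - P (Fin.snoc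 x (a x)) / (1 - q (Fin.snoc x (a x))) ^ (d + 1)) → Literature.NumberTheory.Transcendental.KZ.of r - Literature.NumberTheory.Transcendental.KZ.of r' ∈ Literature.NumberTheory.Transcendental.KZ.relations

/-- item stmt-KontsevichZagierPeriods-6878 · support · rank 9 · closed · proved by Summit.KontsevichZagierPeriods.WZCosetWall.bauerAnchorOne_proof @ a492c9256206 (prover) · by planner
sources: doi:10.1142/9789812797131_0009, Zudilin2008
[support] Calibration of the dictionary at a TERMINATING anchor (card item TerminatingAnchors):
Ekhad–Zeilberger's S(1) = Σ_{n≤1}(4n+1)(−1)^n c_n²(−1)_n/(5/2)_n = 3/2 reads, with (−1)_n/n! ↦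
coefficients of (1−X), n!/(5/2)_n ↦ (3/2)∫x^n(1−x)^{1/2}, as
∫_{(0,1)³}(x₀x₁(1−x₀)(1−x₁))^{−1/2}·√(1−x₂)·(1+5x₀x₁x₂) = π² = ∫_{(0,1)²}(x₀(1−x₀)x₁(1−x₁))^{−1/2}
(both checked to 1e-10). Chain on paper (6 moves): integrand additivity; Newton–Leibniz in x₂ with
primitives −(2/3)(1−x₂)^{3/2} and the polynomial×(1−x₂)^{3/2} primitive of x₂√(1−x₂) (values 2/3 and
4/15); the contiguity IBP x^{1/2}(1−x)^{−1/2} ~ (1/2)x^{−1/2}(1−x)^{−1/2} (primitive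
x^{1/2}(1−x)^{1/2}) in x₀ and in x₁; additivity (2/3 + 1/3 = 1, constants carried inside integrands,
no division of relations). [difficulty: provable-now] -/
@[route_item "route-KontsevichZagierPeriods-WZCosetWall"]
def BauerAnchorOne : Prop :=
  ∀ (r : Literature.NumberTheory.Transcendental.KZ.IntegralRep 3) (r' : Literature.NumberTheory.Transcendental.KZ.IntegralRep 2), r.domain = {x | ∀ i, x i ∈ Set.Ioo (0:ℝ) 1} → Set.EqOn r.integrand (fun x => (x 0 * (1 - x 0) * (x 1 * (1 - x 1))) ^ (-(1:ℝ)/2) * Real.sqrt (1 - x 2) * (1 + 5 * (x 0 * x 1 * x 2))) r.domain → r'.domain = {z | ∀ i, z i ∈ Set.Ioo (0:ℝ) 1} → Set.EqOn r'.integrand (fun z => (z 0 * (1 - z 0) * (z 1 * (1 - z 1))) ^ (-(1:ℝ)/2)) r'.domain → Literature.NumberTheory.Transcendental.KZ.Equivalent r r'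

/-- item stmt-KontsevichZagierPeriods-6879 · support · rank 9 · closed · proved by Summit.KontsevichZagierPeriods.WZCosetWall.zetaTwoOddEven_proof @ 410300963134 (prover) · by planner
sources: KontsevichZagier2001, BeukersCalabiKolk1993
[support] The simplest instance of "Σ is a geometric series", and a gap in KZ's own
accessible-identity example: KontsevichZagier2001 §1.2 (p. 9 read) expands 1/(1−xy) as a geometric
series and integrates termwise to get I = ∫∫_{(0,1)²} dxdy/((1−xy)√(xy)) = Σ 1/(n+½)² = 3ζ(2) — a
passage between the reps [(0,1)², (xy)^{−1/2}/(1−xy)] and [(0,1)², 3/(1−xy)] (both π²/2) that rules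
1)–3) must supply. Compiled: the even/odd splitting of Σ 1/m² is the POINTWISE identity 1/(1−xy) =
1/(1−x²y²) + xy/(1−x²y²) (integrand additivity) plus the squaring maps (x,y) ↦ (x²,y²) (rule 2: [
(xy)^{−1/2}/(1−xy) ] = 4·[1/(1−x²y²)], [ xy/(1−x²y²) ] = ¼·[1/(1−uv)]) and integer bookkeeping by
additivity. A prover warm-up with exactly the shape of the engine (d = 0, q = xy and q = x²y²).
[difficulty: provable-now] -/
@[route_item "route-KontsevichZagierPeriods-WZCosetWall"]
def ZetaTwoOddEven : Prop :=
  ∀ (r r' : Literature.NumberTheory.Transcendental.KZ.IntegralRep 2), r.domain = {z | ∀ i, z i ∈ Set.Ioo (0:ℝ) 1} → Set.EqOn r.integrand (fun z => (z 0 * z 1) ^ (-(1:ℝ)/2) / (1 - z 0 * z 1)) r.domain → r'.domain = {z | ∀ i, z i ∈ Set.Ioo (0:ℝ) 1} → Set.EqOn r'.integrand (fun z => 3 / (1 - z 0 * z 1)) r'.domain → Literature.NumberTheory.Transcendental.KZ.Equivalent r r'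

/-- item stmt-KontsevichZagierPeriods-6880 · assembly · rank 1 · closed · proved by Summit.KontsevichZagierPeriods.WZCosetWall.assembly_proof @ d7bac4af39de (prover) · by planner
sources: KontsevichZagier2001, HuberMullerStach2017
[assembly] SummationClosure → SeriesKernel → KontsevichZagierPeriods. -/
@[route_item "route-KontsevichZagierPeriods-WZCosetWall"]
def Assembly : Prop :=
  SummationClosure → SeriesKernel → KontsevichZagierPeriods

/-! D-0027 §2.1 — DECIDING THEOREM (planner-authored via `route open/edit --closes-file`; by planner-rbadge-KontsevichZagierPeriods-WZCoset-8d928d72-g2-0 2026-08-15T16:10:58Z):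
its hypotheses are this route's items and its conclusion the sub-problem Statement (glue_lint), and it elaborates with this file. -/

@[closes "route-KontsevichZagierPeriods-WZCosetWall"] theorem closes : SummationClosure → SeriesKernel → KontsevichZagierPeriods := by
  intro hS hK n m r r' _ _ hv
  apply hK Literature.NumberTheory.Transcendental.KZ.relations le_rfl hS
  simp [Literature.NumberTheory.Transcendental.KZ.eval_of, hv]

end Summit.KontsevichZagierPeriods.KontsevichZagierPeriods.Theses.WZCosetWall
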